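import Summits.BirchSwinnertonDyer.Rank1Residual.GaloisImage.KolyvaginPrimeTorsionCount
import Summits.BirchSwinnertonDyer.Rank1Residual.GaloisImage.KolyvaginScalarTransport
import HarnessLib

/-!
# The level-1 cyclicity flag from the point count: `¬ p² ∣ #Ẽ(𝔽_ℓ) ⟹ #Ẽ_v(k_v)[p] ≤ p`
# (cell `b2b-bsdres`, team n1011, ROUTE-1 §29.5 sub-target R1-50 — OPTIONAL, S, "anyone idle";
# offered to this seat by n1011-p18 GEN 5, INBOX 13:57Z; seat p11 gen 4)

HONEST FRAMING (cell `b2b-bsdres`, run/shared/lean/b2b/bsd-rank1-residual/, verbatim in every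
file): the goal of the cell is to DELETE the COMBINATION-SHAPED residual classes of the
Birch–Swinnerton-Dyer formula for ALL analytic-rank `≤ 1` elliptic curves over `ℚ` — "full BSD
formula for every rank `≤ 1` curve in class `C`" assembled STRICTLY from published theorems — so
that the rank-`≤ 1` remainder becomes exactly the CONSTRUCTION-SHAPED classes, which are TYPED
(missing-input `Prop`s), NOT attempted. This is not "finishing BSD". Team n1011 (N10 / N11, the
additive block X4 ∧ `p = 3`): research route; TOOL theorem only (no definition, no named fact,
no `sorry`); nothing is booked; no mark / label moved.

## What

The per-prime CYCLICITY FLAG `hflag : #Ẽ_v(k_v)[p] ≤ p` of n1011-p09's / n1011-p18's Kolyvagin-prime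
membership theorems (`FrobShape.exists_frobenius_kernel_data`, `…mem_frobeniusClassPrimes_of_kolyvaginPrime`,
p275986) is implied by the x11c-style point-count column `¬ p² ∣ #Ẽ(𝔽_ℓ)`: the `p`-torsion
subgroup of the finite group `Ẽ_v(k_v)` is a `p`-group (order `p^a`, n1011-p11's
`Transport.exists_natCard_eq_pow_of_nsmul_eq_zero`), its order divides
`#Ẽ_v(k_v) = reductionPointCount W ℓ` (Lagrange; the tree's `natCard_point_reduction_minimal_baseChange`,
Silverman VII.1.3 (b)), so `a ≤ 1`.

* `natCard_torsionBy_reductionAt_le_of_not_sq_dvd` — the flag, for every prime `p` and every prime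
  `ℓ` (no good-reduction or `ℓ ≠ p` hypothesis is needed for the count).

References: J. H. Silverman, *AEC*, Prop. VII.1.3 (b); ROUTE-1 §29.5 (route planner 1, GEN 17).
-/

noncomputable section

open scoped Classical NumberField
open NumberField IsDedekindDomain IsDedekindDomain.HeightOneSpectrum Field WeierstrassCurve
open Literature.NumberTheory.EllipticCurves

namespace Summit.BirchSwinnertonDyer.Rank1Residual.GaloisImage.FrobShape

/-- **The level-1 cyclicity flag from the point count.**  For `E/ℚ` with globally minimal model
`W`, primes `p` and `ℓ`, `v` the place of `ℚ` at `ℓ`: if `p² ∤ #Ẽ(𝔽_ℓ)` (`W.reductionPointCount ℓ`)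
then the `p`-torsion of the reduction `Ẽ_v(k_v) = (W.reductionAt v)(k_v)` has at most `p` points
(`Ẽ_v(k_v)[p]` is a `p`-group whose order divides `#Ẽ_v(k_v) = #Ẽ(𝔽_ℓ)`).  = the binder `hflag`
of `exists_frobenius_kernel_data` / `mem_frobeniusClassPrimes_of_kolyvaginPrime` at level `1`.
[cite: SilvermanAEC2009, Prop. VII.1.3(b), p. 186] -/
theorem natCard_torsionBy_reductionAt_le_of_not_sq_dvd (W : WeierstrassCurve ℚ) [W.IsElliptic]
    [W.IsGloballyMinimal] (p ℓ : ℕ) [Fact p.Prime] [Fact ℓ.Prime] {v : HeightOneSpectrum (𝓞 ℚ)}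
    (hv : (ℓ : 𝓞 ℚ) ∈ v.asIdeal) (h : ¬ p ^ 2 ∣ W.reductionPointCount ℓ) :
    Nat.card (AddSubgroup.torsionBy (W.reductionAt v).toAffine.Point (p : ℕ)) ≤ p := by
  have hp : p.Prime := Fact.out
  have hℓ : ℓ.Prime := Fact.out
  have hvℓ : (Rat.HeightOneSpectrum.primesEquiv v : ℕ) = ℓ := primesEquiv_eq_of_natCast_mem hℓ hv
  have hcardA : Nat.card (W.reductionAt v).toAffine.Point = W.reductionPointCount ℓ := by
    rw [← hvℓ]
    exact natCard_point_reduction_minimal_baseChange v W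
  haveI : Finite (W.reductionAt v).toAffine.Point :=
    Nat.finite_of_card_ne_zero (by rw [hcardA]; exact (W.reductionPointCount_pos ℓ).ne')
  set T := AddSubgroup.torsionBy (W.reductionAt v).toAffine.Point (p : ℕ) with hT
  -- `T` is a `p`-group
  obtain ⟨a, ha⟩ := Transport.exists_natCard_eq_pow_of_nsmul_eq_zero (p := p) (K := 1) (X := T)
    (fun x => by rw [pow_one]; exact AddSubgroup.torsionBy.nsmul x)
  -- its order divides `#Ẽ(𝔽_ℓ)`, which `p²` does not
  have hdvd : p ^ a ∣ W.reductionPointCount ℓ := by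
    rw [← ha, ← hcardA]
    exact AddSubgroup.card_addSubgroup_dvd_card T
  have ha1 : a ≤ 1 := by
    by_contra hlt
    exact h ((pow_dvd_pow p (by omega)).trans hdvd)
  rw [ha]
  calc p ^ a ≤ p ^ 1 := Nat.pow_le_pow_right hp.pos ha1
    _ = p := pow_one p

end Summit.BirchSwinnertonDyer.Rank1Residual.GaloisImage.FrobShape

end
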